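import Summits.QuantumFields.YangMills.Theorems.BalabanUVNodesN18KingModelLineReadouts

/-!
# BalabanUVNodes ∕ N18 — THE POLYMER REPRESENTATION OF KING'S MODEL ON THE END'S CARRIERS: the two runs' (4.42) graphs,
# smeared with any configuration-dependent test weights, ARE sums over Bałaban's torus catalogue `𝐃_j` of localized,
# configuration-dependent activities whose η-rate is `NE5` BY NAME on `torusCarriers` ∕ `reFunctional` (Track A, DAG node
# N18 = NE5 `T4OutputRate.NE5 EA EB W κ θ C₅` :211; director-ym R134 row n18 s3 «King-model transfer `N18KingModelTorus`
# (κ, C₅ from (d, L, a, m², γ)) → `TwoRunTorusNE5Final*`», module 4b of seat pub-ymgap-dag-n18-e)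

HONEST FRAMING.  Count-neutral kernel bookkeeping (seat pub-ymgap-dag-n18-e g4, strategy s3; `--supports` K3′
`SpineGivenEndpointR12`, helper).  King's `A = 0` scalar MODEL ([King1986], printed and proved, typed by seats n18-a∕n18-b) —
NOT Bałaban's covariant one-step outputs `E^{(j)}(X; g, U_k(V))` of [Balaban1987RG1] (0.24)∕(2.13), for which NE5 is NOT
IN PRINT and has no tree producer (NODE O instance 0∕1); NOT a node discharge; finite tori; nothing continuum ∕ ℝ⁴ ∕ OS ∕
mass-gap ∕ Clay.  THEOREMS ONLY: 0 `def`, 0 `sorry`, standard axioms.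

THE POINT.  Modules 1–3 of this seat (`N18KingModelEndDecay` p458808, `N18EndCarriersLineSums` p459720,
`N18KingModelAllLines` p465902) prove `NE5` on the END's carriers for read-outs `K_A, K_B` that are BINDERS with the
hypothesis `K_A X − K_B X = Σ_{lines of X} (G_A − G_B)`, read FIELD-BLIND, and module 3 §3 supplies the selection reading
without defining a read-out: nowhere was (0.24), `E^{(j)}(g, U) = Σ_{X ∈ 𝐃_j} E^{(j)}(X; g, U)` ([Balaban1987RG1] p. 257),
stated in the model.  With module 4a (`N18KingModelLineReadouts`: `sum_tdom_selection`, `selection_reading_local`,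
`ne5_reFunctional_of_fieldCubePairs`, `abs_kingGraph_sub_le_of_readings`) this file states and proves it:
**`kingModel_polymerRep_ne5`** (d = 4, ρ = 1∕4, END tori `N j = L·M_{j+1}`) — `∃ κ > 0, C₅ ≥ 0` ((L, a, m², γ) and d = 4
only) such that for every `n ≥ 1`, Bałaban volumes `L·M_k = 2L^{m_k}`, END data `W`, window `W′`, and every
scale∕configuration-indexed family of TEST WEIGHTS `w_j(φ)(p, q)` with `|w| ≤ 1` (the SAME insertion in both runs — NE5's
«at fixed arguments»; e.g. `w_j(φ)(p, q) = φ(p)φ(q)` for a block field bounded by one: the quadratic form of the effective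
action), there are ACTIVITIES `K_A, K_B : (X : Σ j, 𝐃_j) → (W X.1).Φ → ℝ` with
(a) `NE5 (torusCarriers N W) (reFunctional … K_A) (reFunctional … K_B) W′ (κ∕8) (L^{−γ∕2}) (C₅·(4·2^4)²·2!(8∕κ)²e^{κ∕8})`;
(b) RESUMMATION, (0.24) in the model: `Σ_{X ∈ 𝐃_j} K_A⟨j, X⟩ φ = Σ_{(p,q)} w_j(φ)(p,q)·[ℋ_{j+1} C^{(j+1)} ℋ_{j+1}](L^{j+1}p, L^{j+1}q)`
for every `j, φ`, and the same for run B on King's level `j + 1 + n` (base points `site p 0`, the corner of block `p`: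
[King1986] p. 664 «x′ ∈ B^n(x)»);
(c) LOCALITY: `K_A⟨j, X⟩ φ`, `K_B⟨j, X⟩ φ` are the `w`-weighted sums of their run's graph over ONE AND THE SAME set of
LINES OF `X` (pairs of cubes of `X`: those whose selected connecting polymer — module 1 §3 `exists_live_domain`, `X ∋ p, q`,
`¼·d_j(X) ≤ |p − q|_{T₁}` — is `X`).
Proof: module 4a §3 per line at the base-point readings, `e^{−κ|p−q|} ≤ e^{−(κ∕4)d_j(X)}` on selected lines, `θ^{j+1} ≤ θ^j`,
module 4a §2 with `κ∕4`; (b) is `sum_tdom_selection`; (c) is `selection_reading_local`.  `polymerRep_letters`: the letters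
have content.
WHAT THIS DOES NOT DO.  Lines are pairs of BLOCKS read at the blocks' base points (fine-point multiplicity and King's
(2.20)-rescaling `(L^jη)^{2−d−γ}` stay outside, as in the whole n18-a∕-e lineage); the test weights are external data (no
claim that `φ ↦ w_j(φ)` is Bałaban's small-field functional); `A = 0`, `g`∕`U` unread; NOT Bałaban's `E^{(j)}(X; g, U)`.

Sources: C. King, Commun. Math. Phys. **102** (1986) 649–677 [King1986] — Prop. 3.9 (3.73) p. 665, (4.42)–(4.43) p. 675,
p. 664; T. Bałaban, Commun. Math. Phys. **109** (1987) 249–301 [Balaban1987RG1] — (0.24)–(0.25) p. 257 (localization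
expansions over `𝐃_j`, `d_j(X)`), Thm 1 p. 259; **116** (1988) 1–22 [Balaban1988RG2Cluster] (2.30) p. 18; **102** (1985)
255–275 [Balaban1985UV3] p. 262 (*"The localizations {□_j} and the walks ω replacing lines of the graph define a
localization X"*).  No claim about the mass gap.
-/

noncomputable section

namespace Summit.QuantumFields.YangMills.BalabanUVNodes.N18KingModelPolymerRep

open Matrix
open Literature.MathematicalPhysics.QuantumFieldTheory.Balaban1983to89
open Literature.MathematicalPhysics.QuantumFieldTheory.Balaban1983to89.T4OutputRate (NE5)
open Literature.MathematicalPhysics.QuantumFieldTheory.Balaban1983to89.B5Prop11Plancherel (Tor fine)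
open Literature.MathematicalPhysics.QuantumFieldTheory.Balaban1983to89.TreeLengthTorus (TPt TDom torusTreeLen)
open Literature.MathematicalPhysics.QuantumFieldTheory.Balaban1983to89.B13Lemma3Torus (TwoTorusStep)
open Literature.MathematicalPhysics.QuantumFieldTheory.King1986 (aK)
open Literature.MathematicalPhysics.QuantumFieldTheory.King1986.Torus
  (minimiser effLaplacian blockProj site val_site blockOf_site tdistT)
open Summit.QuantumFields.BalabanUV.T4Continuum.Spine.NE5.TwoRunTorusNE5 (torusCarriers reFunctional)
open Summit.QuantumFields.YangMills.BalabanUVNodes.N18KingModel (kingTheta_pos kingTheta_le_one)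
open Summit.QuantumFields.YangMills.BalabanUVNodes.N18KingModelEndDecay (exists_live_domain endCarriers_decay_letters)
open Summit.QuantumFields.YangMills.BalabanUVNodes.N18KingModelLineReadouts
  (sum_tdom_selection selection_reading_local ne5_reFunctional_of_fieldCubePairs abs_kingGraph_sub_le_of_readings)

/-! ## The polymer representation of King's model, with `NE5` located activities (d = 4, ρ = 1∕4) -/

section Capstone
variable {L' : ℕ} [NeZero L']

open Classical in
/-- **THE POLYMER REPRESENTATION OF KING'S MODEL ON THE END'S CARRIERS.**  For odd `L > 1`, `a > 0`, `m² > 0`, `0 ≤ γ ≤ 1`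
there are `κ > 0`, `C₅ ≥ 0` — functions of `L, a, m², γ` (and `d = 4`) ONLY — such that: for every `n ≥ 1`; every family
of Bałaban volumes `L·M_k = 2L^{m_k}` (END tori `(ℤ∕(L·M_{j+1}))^4` at scale `j` = King's unit torus of level `j + 1`);
every END data `W j : TwoTorusStep 4 L′ (L·M_{j+1})`; every family of TEST WEIGHTS `w_j(φ)(p, q)` indexed by the scale,
the scale-`j` configuration `φ : (W j).Φ` and the ordered pairs of blocks, with `|w_j(φ)(p, q)| ≤ 1` (the SAME insertion in
both runs; e.g. `φ(p)φ(q)` for a block field bounded by one — the quadratic form); and every window `W′` — there are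
CONFIGURATION-DEPENDENT ACTIVITIES `K_A, K_B : (X : Σ j, 𝐃_j) → (W X.1).Φ → ℝ` such that
(a) `NE5 (torusCarriers N W) (reFunctional N W K_A) (reFunctional N W K_B) W′ (κ∕8) (L^{−γ∕2}) (C₅·(4·2^4)²·(2!(8∕κ)²e^{κ∕8}))`
— the typed estimate of record BY NAME on the carriers and read-out of `TwoRunTorusNE5Final8.ne5_end_final_all8`;
(b) RESUMMATION ((0.24) in the model): for every scale `j` and configuration `φ`,
`Σ_{X ∈ 𝐃_j} K_A⟨j, X⟩ φ = Σ_{(p,q)} w_j(φ)(p,q)·Σ_{z,w} ℋ_{j+1}(L^{j+1}p, z)·C^{(j+1)}(z, w)·ℋ_{j+1}(L^{j+1}q, w)` — run A's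
(4.42) graph between the base points of the blocks, smeared with `w` — and the same for `K_B` with run B's graph on level
`j + 1 + n` (base points `L^nL^{j+1}p`: `site p 0`, [King1986] p. 664 «x′ ∈ B^n(x)»);
(c) LOCALITY: every `K_A⟨j, X⟩ φ`, `K_B⟨j, X⟩ φ` is the `w`-weighted sum of its run's graph over ONE AND THE SAME set of lines
`(p, q)` OF `X` (pairs of cubes of `X`: those whose selected connecting polymer — `N18KingModelEndDecay.exists_live_domain`,
`X ∋ p, q`, `¼·d_j(X) ≤ |p − q|_{T₁}` — is `X`).
Proof: §3 per line at the base-point readings (`val_site`, `blockOf_site`), `e^{−κ|p − q|} ≤ e^{−(κ∕4)·d_j(X)}` on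
selected lines, `θ^{j+1} ≤ θ^j`, §2 `ne5_reFunctional_of_fieldCubePairs` with `κ∕4`; (b) is §1 `sum_tdom_selection`;
(c) is `Finset.sum_filter`.  A = 0 MODEL; every line of the torus carried exactly once.
[cite: King1986, Prop. 3.9 (3.73) p.665, (4.42)–(4.43) p.675, p.664; Balaban1987RG1, (0.24)-(0.25) p.257, Thm 1 p.259; Balaban1988RG2Cluster, (2.30) p.18; Balaban1985UV3, p.262] -/
theorem kingModel_polymerRep_ne5 (L : ℕ) [NeZero L] (hLp : Odd L ∧ 1 < L) {a m2 : ℝ} (ha : 0 < a) (hm : 0 < m2)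
    {γ : ℝ} (hγ0 : 0 ≤ γ) (hγ1 : γ ≤ 1) :
    ∃ κ C₅ : ℝ, 0 < κ ∧ 0 ≤ C₅ ∧
      ∀ (n : ℕ) (_hn : 1 ≤ n) (M : ℕ → ℕ) [∀ k, NeZero (M k)] (_hM : ∀ k, ∃ mm : ℕ, L * M k = 2 * L ^ mm)
        (W : (j : ℕ) → TwoTorusStep 4 L' (L * M (j + 1)))
        (w : (j : ℕ) → (W j).Φ → TPt 4 (L * M (j + 1)) × TPt 4 (L * M (j + 1)) → ℝ)
        (_hw : ∀ j φ pq, |w j φ pq| ≤ 1) (W' : Set (ℕ → ℝ)),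
        ∃ KA KB : (X : Σ j : ℕ, TDom 4 (L * M (j + 1))) → (W X.1).Φ → ℝ,
          NE5 (C := torusCarriers (fun j => L * M (j + 1)) W)
              (reFunctional (fun j => L * M (j + 1)) W fun j X φ => ((KA ⟨j, X⟩ φ : ℝ) : ℂ))
              (reFunctional (fun j => L * M (j + 1)) W fun j X φ => ((KB ⟨j, X⟩ φ : ℝ) : ℂ)) W' (κ / 8)
              ((L : ℝ) ^ (-(γ / 2)))
              (C₅ * (4 * 2 ^ 4) ^ 2 * (((2 : ℕ).factorial : ℝ) * (8 / κ) ^ 2 * Real.exp (κ / 8))) ∧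
          (∀ (j : ℕ) (φ : (W j).Φ), ∑ X : TDom 4 (L * M (j + 1)), KA ⟨j, X⟩ φ =
            ∑ pq : TPt 4 (L * M (j + 1)) × TPt 4 (L * M (j + 1)), w j φ pq *
              ((fun z => minimiser (L ^ (j + 1)) (fine L (fun _ : Fin 4 => M (j + 1))) (aK a L (j + 1))
                    (((L ^ (j + 1) : ℕ) : ℝ) ^ 2) m2 (Pi.single z 1)
                    (site (L ^ (j + 1)) (fine L (fun _ : Fin 4 => M (j + 1))) pq.1 fun _ => 0))
                ⬝ᵥ ((effLaplacian (L ^ (j + 1)) (fine L (fun _ : Fin 4 => M (j + 1))) (aK a L (j + 1))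
                        (((L ^ (j + 1) : ℕ) : ℝ) ^ 2) m2
                      + (a * ((L : ℝ) ^ 2)⁻¹) • blockProj L (fun _ : Fin 4 => M (j + 1)))⁻¹
                    *ᵥ fun w' => minimiser (L ^ (j + 1)) (fine L (fun _ : Fin 4 => M (j + 1))) (aK a L (j + 1))
                        (((L ^ (j + 1) : ℕ) : ℝ) ^ 2) m2 (Pi.single w' 1)
                        (site (L ^ (j + 1)) (fine L (fun _ : Fin 4 => M (j + 1))) pq.2 fun _ => 0)))) ∧
          (∀ (j : ℕ) (φ : (W j).Φ), ∑ X : TDom 4 (L * M (j + 1)), KB ⟨j, X⟩ φ =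
            ∑ pq : TPt 4 (L * M (j + 1)) × TPt 4 (L * M (j + 1)), w j φ pq *
              ((fun z => minimiser (L ^ n * L ^ (j + 1)) (fine L (fun _ : Fin 4 => M (j + 1))) (aK a L (j + 1 + n))
                    (((L ^ n * L ^ (j + 1) : ℕ) : ℝ) ^ 2) m2 (Pi.single z 1)
                    (site (L ^ n * L ^ (j + 1)) (fine L (fun _ : Fin 4 => M (j + 1))) pq.1 fun _ => 0))
                ⬝ᵥ ((effLaplacian (L ^ n * L ^ (j + 1)) (fine L (fun _ : Fin 4 => M (j + 1))) (aK a L (j + 1 + n))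
                        (((L ^ n * L ^ (j + 1) : ℕ) : ℝ) ^ 2) m2
                      + (a * ((L : ℝ) ^ 2)⁻¹) • blockProj L (fun _ : Fin 4 => M (j + 1)))⁻¹
                    *ᵥ fun w' => minimiser (L ^ n * L ^ (j + 1)) (fine L (fun _ : Fin 4 => M (j + 1)))
                        (aK a L (j + 1 + n)) (((L ^ n * L ^ (j + 1) : ℕ) : ℝ) ^ 2) m2 (Pi.single w' 1)
                        (site (L ^ n * L ^ (j + 1)) (fine L (fun _ : Fin 4 => M (j + 1))) pq.2 fun _ => 0)))) ∧
          (∀ (j : ℕ) (X : TDom 4 (L * M (j + 1))) (φ : (W j).Φ), ∃ S : Finset (TPt 4 (L * M (j + 1)) × TPt 4 (L * M (j + 1))),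
            S ⊆ X.1 ×ˢ X.1 ∧
            KA ⟨j, X⟩ φ = ∑ pq ∈ S, w j φ pq *
              ((fun z => minimiser (L ^ (j + 1)) (fine L (fun _ : Fin 4 => M (j + 1))) (aK a L (j + 1))
                    (((L ^ (j + 1) : ℕ) : ℝ) ^ 2) m2 (Pi.single z 1)
                    (site (L ^ (j + 1)) (fine L (fun _ : Fin 4 => M (j + 1))) pq.1 fun _ => 0))
                ⬝ᵥ ((effLaplacian (L ^ (j + 1)) (fine L (fun _ : Fin 4 => M (j + 1))) (aK a L (j + 1))
                        (((L ^ (j + 1) : ℕ) : ℝ) ^ 2) m2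
                      + (a * ((L : ℝ) ^ 2)⁻¹) • blockProj L (fun _ : Fin 4 => M (j + 1)))⁻¹
                    *ᵥ fun w' => minimiser (L ^ (j + 1)) (fine L (fun _ : Fin 4 => M (j + 1))) (aK a L (j + 1))
                        (((L ^ (j + 1) : ℕ) : ℝ) ^ 2) m2 (Pi.single w' 1)
                        (site (L ^ (j + 1)) (fine L (fun _ : Fin 4 => M (j + 1))) pq.2 fun _ => 0))) ∧
            KB ⟨j, X⟩ φ = ∑ pq ∈ S, w j φ pq *
              ((fun z => minimiser (L ^ n * L ^ (j + 1)) (fine L (fun _ : Fin 4 => M (j + 1))) (aK a L (j + 1 + n))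
                    (((L ^ n * L ^ (j + 1) : ℕ) : ℝ) ^ 2) m2 (Pi.single z 1)
                    (site (L ^ n * L ^ (j + 1)) (fine L (fun _ : Fin 4 => M (j + 1))) pq.1 fun _ => 0))
                ⬝ᵥ ((effLaplacian (L ^ n * L ^ (j + 1)) (fine L (fun _ : Fin 4 => M (j + 1))) (aK a L (j + 1 + n))
                        (((L ^ n * L ^ (j + 1) : ℕ) : ℝ) ^ 2) m2
                      + (a * ((L : ℝ) ^ 2)⁻¹) • blockProj L (fun _ : Fin 4 => M (j + 1)))⁻¹
                    *ᵥ fun w' => minimiser (L ^ n * L ^ (j + 1)) (fine L (fun _ : Fin 4 => M (j + 1)))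
                        (aK a L (j + 1 + n)) (((L ^ n * L ^ (j + 1) : ℕ) : ℝ) ^ 2) m2 (Pi.single w' 1)
                        (site (L ^ n * L ^ (j + 1)) (fine L (fun _ : Fin 4 => M (j + 1))) pq.2 fun _ => 0)))) := by
  obtain ⟨κ, C₅, hκ, hC₅, H⟩ := abs_kingGraph_sub_le_of_readings (d := 4) (by norm_num) L hLp ha hm hγ0 hγ1
  refine ⟨κ, C₅, hκ, hC₅, ?_⟩
  intro n hn M _ hM W w hw W'
  set θ : ℝ := (L : ℝ) ^ (-(γ / 2)) with hθ_def
  have hL1 : 1 ≤ L := by have := hLp.2; omega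
  have hL0 : 0 < L := Nat.pos_of_ne_zero (NeZero.ne L)
  have hLn : 0 < L ^ n := pow_pos hL0 n
  have hθ0 : 0 ≤ θ := (kingTheta_pos hL1 (γ / 2)).le
  have hθ1 : θ ≤ 1 := kingTheta_le_one hL1 (by linarith)
  -- the two runs' (4.42) graphs between the base points of a pair of blocks, at END scale `j` (King level `j + 1`)
  let GA : (j : ℕ) → TPt 4 (L * M (j + 1)) × TPt 4 (L * M (j + 1)) → ℝ := fun j pq =>
    (fun z => minimiser (L ^ (j + 1)) (fine L (fun _ : Fin 4 => M (j + 1))) (aK a L (j + 1))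
          (((L ^ (j + 1) : ℕ) : ℝ) ^ 2) m2 (Pi.single z 1)
          (site (L ^ (j + 1)) (fine L (fun _ : Fin 4 => M (j + 1))) pq.1 fun _ => 0))
      ⬝ᵥ ((effLaplacian (L ^ (j + 1)) (fine L (fun _ : Fin 4 => M (j + 1))) (aK a L (j + 1))
              (((L ^ (j + 1) : ℕ) : ℝ) ^ 2) m2
            + (a * ((L : ℝ) ^ 2)⁻¹) • blockProj L (fun _ : Fin 4 => M (j + 1)))⁻¹
          *ᵥ fun w' => minimiser (L ^ (j + 1)) (fine L (fun _ : Fin 4 => M (j + 1))) (aK a L (j + 1))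
              (((L ^ (j + 1) : ℕ) : ℝ) ^ 2) m2 (Pi.single w' 1)
              (site (L ^ (j + 1)) (fine L (fun _ : Fin 4 => M (j + 1))) pq.2 fun _ => 0))
  let GB : (j : ℕ) → TPt 4 (L * M (j + 1)) × TPt 4 (L * M (j + 1)) → ℝ := fun j pq =>
    (fun z => minimiser (L ^ n * L ^ (j + 1)) (fine L (fun _ : Fin 4 => M (j + 1))) (aK a L (j + 1 + n))
          (((L ^ n * L ^ (j + 1) : ℕ) : ℝ) ^ 2) m2 (Pi.single z 1)
          (site (L ^ n * L ^ (j + 1)) (fine L (fun _ : Fin 4 => M (j + 1))) pq.1 fun _ => 0))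
      ⬝ᵥ ((effLaplacian (L ^ n * L ^ (j + 1)) (fine L (fun _ : Fin 4 => M (j + 1))) (aK a L (j + 1 + n))
              (((L ^ n * L ^ (j + 1) : ℕ) : ℝ) ^ 2) m2
            + (a * ((L : ℝ) ^ 2)⁻¹) • blockProj L (fun _ : Fin 4 => M (j + 1)))⁻¹
          *ᵥ fun w' => minimiser (L ^ n * L ^ (j + 1)) (fine L (fun _ : Fin 4 => M (j + 1)))
              (aK a L (j + 1 + n)) (((L ^ n * L ^ (j + 1) : ℕ) : ℝ) ^ 2) m2 (Pi.single w' 1)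
              (site (L ^ n * L ^ (j + 1)) (fine L (fun _ : Fin 4 => M (j + 1))) pq.2 fun _ => 0))
  -- a connecting polymer for every pair of blocks at every scale (module 1 §3)
  choose Xs hXs using fun (j : ℕ) (pq : TPt 4 (L * M (j + 1)) × TPt 4 (L * M (j + 1))) =>
    exists_live_domain L (M (j + 1)) pq.1 pq.2
  -- §3 per line at the base-point readings: `|G_A − G_B| ≤ C₅ θ^{j+1} e^{−κ|p − q|}`
  have hline : ∀ (j : ℕ) (pq : TPt 4 (L * M (j + 1)) × TPt 4 (L * M (j + 1))),
      |GA j pq - GB j pq| ≤ C₅ * θ ^ (j + 1) *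
        Real.exp (-(κ * tdistT (fine L (fun _ : Fin 4 => M (j + 1))) pq.1 pq.2)) := by
    intro j pq
    have h := H n hn (fun k (_ : Fin 4) => M k) (fun k => by obtain ⟨mm, hmm⟩ := hM k; exact ⟨mm, fun _ => hmm⟩)
      (Σ j : ℕ, TPt 4 (L * M (j + 1)) × TPt 4 (L * M (j + 1))) (fun l => l.1 + 1) (fun _ => Nat.succ_pos _)
      (fun l => site (L ^ (l.1 + 1)) (fine L (fun _ : Fin 4 => M (l.1 + 1))) l.2.1 fun _ => 0)
      (fun l => site (L ^ (l.1 + 1)) (fine L (fun _ : Fin 4 => M (l.1 + 1))) l.2.2 fun _ => 0)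
      (fun l => site (L ^ n * L ^ (l.1 + 1)) (fine L (fun _ : Fin 4 => M (l.1 + 1))) l.2.1 fun _ => 0)
      (fun l => site (L ^ n * L ^ (l.1 + 1)) (fine L (fun _ : Fin 4 => M (l.1 + 1))) l.2.2 fun _ => 0)
      (fun l μ => by
        rw [val_site, val_site]
        simp only [Nat.add_zero, Fin.coe_ofNat_eq_mod, Nat.zero_mod]
        rw [Nat.mul_assoc, Nat.mul_div_cancel_left _ hLn])
      (fun l μ => by
        rw [val_site, val_site]
        simp only [Nat.add_zero, Fin.coe_ofNat_eq_mod, Nat.zero_mod]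
        rw [Nat.mul_assoc, Nat.mul_div_cancel_left _ hLn])
      ⟨j, pq⟩
    rw [blockOf_site, blockOf_site] at h
    exact h
  -- located at the selected connecting polymer: `θ^{j+1} ≤ θ^j`, `e^{−κ|p−q|} ≤ e^{−(κ/4)d_j(X)}`
  have hloc : ∀ (j : ℕ) (pq : TPt 4 (L * M (j + 1)) × TPt 4 (L * M (j + 1))),
      |GA j pq - GB j pq| ≤ C₅ * θ ^ j * Real.exp (-(κ / 4 * torusTreeLen (Xs j pq).1)) := by
    intro j pq
    refine (hline j pq).trans ?_
    refine mul_le_mul (mul_le_mul_of_nonneg_left ?_ hC₅) (Real.exp_le_exp.2 ?_) (Real.exp_pos _).le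
      (mul_nonneg hC₅ (pow_nonneg hθ0 _))
    · calc θ ^ (j + 1) = θ ^ j * θ := pow_succ θ j
        _ ≤ θ ^ j * 1 := mul_le_mul_of_nonneg_left hθ1 (pow_nonneg hθ0 _)
        _ = θ ^ j := mul_one _
    · have := (hXs j pq).2.2
      have : κ * (1 / 4 * torusTreeLen (Xs j pq).1) ≤
          κ * tdistT (fine L (fun _ : Fin 4 => M (j + 1))) pq.1 pq.2 := mul_le_mul_of_nonneg_left this hκ.le
      linarith
  -- the activities: at `⟨j, X⟩`, the `w`-weighted lines of `X` whose selected polymer is `X`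
  refine ⟨fun X φ => ∑ pq ∈ X.2.1 ×ˢ X.2.1, (if Xs X.1 pq = X.2 then w X.1 φ pq * GA X.1 pq else 0),
    fun X φ => ∑ pq ∈ X.2.1 ×ˢ X.2.1, (if Xs X.1 pq = X.2 then w X.1 φ pq * GB X.1 pq else 0), ?_, ?_, ?_, ?_⟩
  · -- (a) NE5: §2 with `κ/4`
    have h := ne5_reFunctional_of_fieldCubePairs (fun j => L * M (j + 1)) W
      (fun X φ => ∑ pq ∈ X.2.1 ×ˢ X.2.1, (if Xs X.1 pq = X.2 then w X.1 φ pq * GA X.1 pq else 0))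
      (fun X φ => ∑ pq ∈ X.2.1 ×ˢ X.2.1, (if Xs X.1 pq = X.2 then w X.1 φ pq * GB X.1 pq else 0))
      (fun X φ pq => if Xs X.1 pq = X.2 then w X.1 φ pq * GA X.1 pq else 0)
      (fun X φ pq => if Xs X.1 pq = X.2 then w X.1 φ pq * GB X.1 pq else 0)
      (κ := κ / 4) (by positivity) hθ0 hC₅ (fun X φ => by rw [← Finset.sum_sub_distrib]) (fun X φ pq _ => by
        by_cases hsel : Xs X.1 pq = X.2
        · rw [if_pos hsel, if_pos hsel, ← mul_sub, abs_mul]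
          have h1 := hloc X.1 pq
          rw [hsel] at h1
          calc |w X.1 φ pq| * |GA X.1 pq - GB X.1 pq| ≤ 1 * |GA X.1 pq - GB X.1 pq| :=
                mul_le_mul_of_nonneg_right (hw X.1 φ pq) (abs_nonneg _)
            _ ≤ C₅ * θ ^ X.1 * Real.exp (-(κ / 4 * torusTreeLen X.2.1)) := by rw [one_mul]; exact h1
        · rw [if_neg hsel, if_neg hsel, sub_self, abs_zero]
          positivity) W'
    have e1 : κ / 4 / 2 = κ / 8 := by ring
    have e2 : (2 : ℝ) / (κ / 4) = 8 / κ := by rw [div_div_eq_mul_div]; norm_num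
    rw [e1, e2] at h
    exact h
  · -- (b) resummation, run A: §1
    intro j φ
    exact sum_tdom_selection (Xs j) (fun pq => Finset.mem_product.2 ⟨(hXs j pq).1, (hXs j pq).2.1⟩)
      (fun pq => w j φ pq * GA j pq)
  · -- (b) resummation, run B: §1
    intro j φ
    exact sum_tdom_selection (Xs j) (fun pq => Finset.mem_product.2 ⟨(hXs j pq).1, (hXs j pq).2.1⟩)
      (fun pq => w j φ pq * GB j pq)
  · -- (c) locality: the same set of lines of `X` in both runs
    intro j X φ
    refine ⟨(X.1 ×ˢ X.1).filter (fun pq => Xs j pq = X), Finset.filter_subset _ _, ?_, ?_⟩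
    · exact selection_reading_local (Xs j) X (fun pq => w j φ pq * GA j pq)
    · exact selection_reading_local (Xs j) X (fun pq => w j φ pq * GB j pq)

/-- The letters of §4 have CONTENT: the END's decay exponent `κ∕8` is positive, the constant
`C₅·(4·2^4)²·(2!(8∕κ)²e^{κ∕8})` is non-negative, and for `γ > 0` the rate `L^{−γ∕2}` lies in `]0, 1[`
(`N18KingModelEndDecay.endCarriers_decay_letters` at `ρ = 1∕4`). [cite: King1986, Prop. 3.9 (3.73) p.665] -/
theorem polymerRep_letters {κ C₅ : ℝ} (hκ : 0 < κ) (hC₅ : 0 ≤ C₅) {L : ℕ} (hL : 2 ≤ L) {γ : ℝ} (hγ : 0 < γ) :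
    0 < κ / 8 ∧ 0 ≤ C₅ * (4 * 2 ^ 4) ^ 2 * (((2 : ℕ).factorial : ℝ) * (8 / κ) ^ 2 * Real.exp (κ / 8)) ∧
      0 < (L : ℝ) ^ (-(γ / 2)) ∧ (L : ℝ) ^ (-(γ / 2)) < 1 := by
  obtain ⟨_, h2, h3⟩ := endCarriers_decay_letters hκ (by norm_num : (0 : ℝ) < 1 / 4) hL hγ
  exact ⟨by positivity, by positivity, h2, h3⟩

end Capstone

end Summit.QuantumFields.YangMills.BalabanUVNodes.N18KingModelPolymerRep

end
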